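import Literature.Probability.LatticeModels.HighDimTrivialityMomentsUrsellProofs
import Literature.Probability.LatticeModels.HighDimTrivialityCorrLengthWindow
import Literature.Probability.LatticeModels.HighDimTrivialityPrintRegimeProofs
import Literature.Probability.LatticeModels.ImprovedTreeDiagramBoundHolds
import HarnessLib

/-!
# Discharge of the `d = 4` bound on `∑ |U₄|` in the critical window and of its consequences

Probability/LatticeModels theorem file (no definitions, no named facts). The improved tree diagram
bound of Aizenman–Duminil-Copin (M. Aizenman, H. Duminil-Copin, *Marginal triviality of the scaling
limits of critical 4D Ising and `φ⁴₄` models*, Ann. of Math. 194 (2021) = arXiv:1912.07973,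
Theorem 1.3) was discharged on 2026-08-16 (`aizenmanDuminilCopin_improvedTreeDiagramBound_holds`,
`ImprovedTreeDiagramBoundHolds.lean`). The tree had already reduced the following named facts to
Theorem 1.3 ALONE (the sliding-scale infrared bound, Thm 5.6, being proved,
`aizenmanDuminilCopin_slidingScaleInfraredBound_holds`):

* `aizenmanDuminilCopin_ursellFourSum_le` (`HighDimTrivialityMoments.lean`; ADC §6.3 p. 26, the
  summed bound feeding Prop. 1.4) — `aizenmanDuminilCopin_ursellFourSum_le_of_improvedTreeDiagramBound`
  (`HighDimTrivialityMomentsUrsellProofs.lean`);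
* `aizenmanDuminilCopin_mgf_normalizedField_bound_abs` (`HighDimTrivialityMoments.lean`; ADC
  Prop. 1.4) — `aizenmanDuminilCopin_mgf_normalizedField_bound_abs_of_improvedTreeDiagramBound`
  (`HighDimTrivialityPrintRegimeProofs.lean`);
* `isGaussianProcess_of_tendstoInDistribution_smearedSpin_printRegime` (`HighDimTriviality.lean`;
  ADC Thm 1.2 / p. 6 with Panis 2023 Thm. 5.5) —
  `isGaussianProcess_of_tendstoInDistribution_smearedSpin_printRegime_of_improvedTreeDiagramBound`
  (`HighDimTrivialityPrintRegimeProofs.lean`);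
* `isGaussianProcess_of_tendstoInDistribution_smearedSpin` (`Sweep1.lean`) —
  `isGaussianProcess_of_tendstoInDistribution_smearedSpin_of_improvedTreeDiagramBound`
  (`HighDimTrivialityCorrLengthWindow.lean`).

This file applies the four reductions to the discharge of Theorem 1.3. It is a sibling file because
`ImprovedTreeDiagramBound.lean` is imported by the whole chain.

## Mathlib / tree search

Tree (all used): the four `…_of_improvedTreeDiagramBound` reductions above and
`aizenmanDuminilCopin_improvedTreeDiagramBound_holds`. `lean search '<fact>_holds'` for the four
facts: nothing before this file (2026-08-16).

## References

* M. Aizenman, H. Duminil-Copin, Ann. of Math. 194 (2021) 163–235 = arXiv:1912.07973: Thm 1.2,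
  Thm 1.3, Prop. 1.4 (p. 6), Thm 5.6 (p. 18), §6.3 (pp. 26–27). [AizenmanDuminilCopinAnnals2021]
* R. Panis, Triviality of the scaling limits of critical Ising and φ⁴ models with effective
  dimension at least four (2023), Thm. 5.5. [Panis2023Triviality]
-/

noncomputable section

namespace Literature.Probability.LatticeModels

/-- **ADC 2021, §6.3 (`d = 4`): the summed `|U₄|` bound in the critical window** — discharged:
the reduction to Theorem 1.3 applied to `aizenmanDuminilCopin_improvedTreeDiagramBound_holds`.
[cite: AizenmanDuminilCopinAnnals2021, arXiv:1912.07973 Thm 1.3 (p. 6), Thm 5.6 (p. 18) and §6.3, bound on S(L,r,β) (pp. 26–27)] -/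
theorem aizenmanDuminilCopin_ursellFourSum_le_holds : aizenmanDuminilCopin_ursellFourSum_le :=
  aizenmanDuminilCopin_ursellFourSum_le_of_improvedTreeDiagramBound
    aizenmanDuminilCopin_improvedTreeDiagramBound_holds

/-- **ADC 2021, Prop. 1.4 (`d = 4`), absolute-value form** — discharged.
[cite: AizenmanDuminilCopinAnnals2021, arXiv:1912.07973 Prop. 1.4 (p. 6), proof §6.3 (p. 26), Thm 1.3 (p. 6), Thm 5.6 (p. 18)] -/
theorem aizenmanDuminilCopin_mgf_normalizedField_bound_abs_holds :
    aizenmanDuminilCopin_mgf_normalizedField_bound_abs :=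
  aizenmanDuminilCopin_mgf_normalizedField_bound_abs_of_improvedTreeDiagramBound
    aizenmanDuminilCopin_improvedTreeDiagramBound_holds

universe u in
/-- **Gaussianity of scaling limits of the critical / near-critical Ising spin field in `d ≥ 4`,
printed regime** (ADC 2021 Thm 1.2 for `d = 4`; Panis 2023 Thm. 5.5 for `d ≥ 5`) — discharged.
[cite: AizenmanDuminilCopinAnnals2021, arXiv:1912.07973 Thm 1.2 and p. 6, Prop. 1.4, Thm 1.3, Thm 5.6, §6.3] [cite: Panis2023Triviality, Thm. 5.5 (d ≥ 5)] -/
theorem isGaussianProcess_of_tendstoInDistribution_smearedSpin_printRegime_holds :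
    isGaussianProcess_of_tendstoInDistribution_smearedSpin_printRegime.{u} :=
  isGaussianProcess_of_tendstoInDistribution_smearedSpin_printRegime_of_improvedTreeDiagramBound
    aizenmanDuminilCopin_improvedTreeDiagramBound_holds

universe u in
/-- **Gaussianity of scaling limits of the Ising spin field in `d ≥ 4`** (`Sweep1` statement
`isGaussianProcess_of_tendstoInDistribution_smearedSpin`) — discharged.
[cite: AizenmanDuminilCopinAnnals2021, arXiv:1912.07973 Thm 1.3 (p. 6), Thm 5.6 (p. 18), §6.3 (pp. 26–27)] -/
theorem isGaussianProcess_of_tendstoInDistribution_smearedSpin_holds :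
    isGaussianProcess_of_tendstoInDistribution_smearedSpin.{u} :=
  isGaussianProcess_of_tendstoInDistribution_smearedSpin_of_improvedTreeDiagramBound
    aizenmanDuminilCopin_improvedTreeDiagramBound_holds

end Literature.Probability.LatticeModels

end
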